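import Literature.Computability.Complexity.NWExtraction
import Literature.Computability.Cryptography.SecretSharing
import HarnessLib

/-!
# Hirahara's reduction: a consistent test makes every formula accept the approximable set

Topic `Computability/Complexity`. The deterministic core of the soundness proof of Hirahara's
reduction from CMMSA to `MCSP*` (ECCC TR22-119, proof of Lemma 8.3, soundness, pp. 28–29, with
Lemma 6.6 and Lemma 4.5), in the counting form of this directory. The sample of the reduction is
indexed by `x = (j, z, ξ)` — a formula index `j`, a Nisan–Wigderson seed `z`, and the share slots
`ξ ∈ ({0,1}^Δ)^{mm}` — and the point of secret `b` and coins `r` is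
`ξ = (NW outputs of the slot variables) ⊕ Share(φⱼ, b; r)` (`HiraharaRed.point`). A test
`g : X → {0,1}` is CONSISTENT if it returns `b` at every such point (`HiraharaRed.Cons`). Let
`B = B(g)` be the set of variables `k` whose padded function `f̂_k` is `η`-approximable (in the sense
of `NWExtract.Approx`) from one of the tests `D_{j,b,r}(z, Y) = [g(j, z, Y|slots ⊕ Share(φⱼ,b;r)) = b]`
(`HiraharaRed.Bset`). **Theorem** (`HiraharaRed.authorized_of_cons`): if `g` is consistent and
`η · mm · Δ < 1/2`, then `B` is an authorized set of EVERY formula `φⱼ` (`φⱼ(χ_B) = 1`).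

Proof: by Lemma 6.6 (`NWExtract.card_real_sub_ideal_le`, exempt set = positions of `B`), for every
`(j, b, r)` the test still accepts with frequency `> 1/2` after the outputs of the variables outside
`B` are replaced by uniform bits; but if `B ∩ vars(φⱼ)` were unauthorized, the privacy of the
Benaloh–Leichter scheme (a coin bijection `Ψ` with equal `B`-shares of `1` under `r` and of `0` under
`Ψ r`) together with the one-time pad on the other slots matches every accepting run for `b = 1`
with a rejecting run for `b = 0`, so the two frequencies average to exactly `1/2` — contradiction.
(Hirahara averages over `j` and obtains `Pr_j[φⱼ(χ_B) = 1] ≥ 1 - 2ε`; with PERFECT consistency, as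
needed for `MCSP*`, the conclusion holds for every `j`.)

## References

* S. Hirahara, *NP-hardness of learning programs and partial MCSP*, ECCC TR22-119, proof of
  Lemma 8.3 (soundness, pp. 28–29), Lemma 6.6, Lemma 4.5 [Hirahara2022PartialMCSP].
-/

namespace Literature.Computability.Complexity

open Finset
open Literature.Computability.Cryptography
open Literature.Computability.MetaComplexity (MonotoneDNF)
open Literature.Computability.MetaComplexity.MonotoneDNF (BenalohLeichter.Rand BenalohLeichter.share)

namespace HiraharaRed

open scoped Classical

variable {n Δ ν ℓ dNW mm : ℕ}

/-! ### The sample: slots, shares, points, consistency -/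

section Sample

variable (E : Fin n × Fin Δ → (Fin ℓ ↪ Fin dNW)) (Fhat : Fin n → (Fin ℓ → Bool) → Bool)
  (φ : Fin ν → MonotoneDNF) (slot : Fin ν → Fin mm → Option (Fin n))

/-- The table index type `X = [ν] × {0,1}^{d} × ({0,1}^Δ)^{mm}` (formula, NW seed, share slots).
[cite: Hirahara2022PartialMCSP, proof of Lemma 8.3 ("(zφ, NW(f̂₁;z)⊕s₁, …)"; j encoded in the sample)] -/
abbrev X (ν dNW mm Δ : ℕ) : Type := Fin ν × (Fin dNW → Bool) × (Fin mm → Fin Δ → Bool)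

/-- The (padded, slotted) share vector of `Share(φⱼ, b; r)`: slot `i` carries the Benaloh–Leichter
share of its variable, truncated/padded to `Δ` bits. [cite: Hirahara2022PartialMCSP, proof of Lemma 8.3 (sᵢ ∈ {0,1}^Δ) and Lemma 4.5] -/
def shareVec (j : Fin ν) (b : Bool) (r : BenalohLeichter.Rand (φ j)) : Fin mm → Fin Δ → Bool :=
  fun i t => match slot j i with
    | some k => (BenalohLeichter.share (φ j) b r k).getD t false
    | none => false

/-- Reading the NW outputs of the slot variables off an output vector `Y`. [cite: Hirahara2022PartialMCSP, proof of Lemma 8.3] -/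
def readY (j : Fin ν) (Y : Fin n × Fin Δ → Bool) : Fin mm → Fin Δ → Bool :=
  fun i t => match slot j i with
    | some k => Y (k, t)
    | none => false

/-- Slotwise XOR. [folklore] -/
def xorV (a c : Fin mm → Fin Δ → Bool) : Fin mm → Fin Δ → Bool := fun i t => xor (a i t) (c i t)

/-- The real NW outputs `Y_{(k,t)} = f̂_k(z|_{S_{(k,t)}})` (`NWExtract.real` with `F_{(k,t)} = f̂_k`).
[cite: Hirahara2022PartialMCSP, proof of Lemma 8.3 (NW^{f̂ᵢ}(z))] -/
def realY (z : Fin dNW → Bool) : Fin n × Fin Δ → Bool := NWExtract.real E (fun p => Fhat p.1) z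

/-- **The sample point** of `(j, z, b, r)`: `(j, z, NW outputs ⊕ shares)`. [cite: Hirahara2022PartialMCSP, proof of Lemma 8.3 (distribution D_b)] -/
def point (j : Fin ν) (z : Fin dNW → Bool) (b : Bool) (r : BenalohLeichter.Rand (φ j)) : X ν dNW mm Δ :=
  (j, z, xorV (readY slot j (realY E Fhat z)) (shareVec φ slot j b r))

/-- **Consistency** of a test with the sample: it answers `b` at every point of secret `b`.
[cite: Hirahara2022PartialMCSP, proof of Lemma 8.3 (a program M computing E_k on its support)] -/
def Cons (g : X ν dNW mm Δ → Bool) : Prop :=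
  ∀ (j : Fin ν) (z : Fin dNW → Bool) (b : Bool) (r : BenalohLeichter.Rand (φ j)), g (point E Fhat φ slot j z b r) = b

/-- **The tests** `D_{j,b,r}(z, Y) = [g(j, z, Y|slots ⊕ Share(φⱼ, b; r)) = b]`. [cite: Hirahara2022PartialMCSP, proof of Lemma 8.3 (the oracle D built from M)] -/
def test (g : X ν dNW mm Δ → Bool) (j : Fin ν) (b : Bool) (r : BenalohLeichter.Rand (φ j))
    (z : Fin dNW → Bool) (Y : Fin n × Fin Δ → Bool) : Bool :=
  (g (j, z, xorV (readY slot j Y) (shareVec φ slot j b r)) == b)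

/-- The positions a test of formula `j` reads: those of its slot variables. [cite: Hirahara2022PartialMCSP, proof of Lemma 6.6 (D depends on m' coordinates)] -/
def readSet (j : Fin ν) : Finset (Fin n × Fin Δ) := univ.filter fun p => ∃ i, slot j i = some p.1

/-- **The approximable variables** `B(g)`: `k` such that `f̂_k` is `η`-approximable at some
position `(k, t)` from some test `D_{j,b,r}`. [cite: Hirahara2022PartialMCSP, proof of Lemma 8.3 (the set B of Lemma 6.6)] -/
noncomputable def Bset (g : X ν dNW mm Δ → Bool) (η : ℝ) : Finset (Fin n) :=
  univ.filter fun k => ∃ (j : Fin ν) (b : Bool) (r : BenalohLeichter.Rand (φ j)) (t : Fin Δ),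
    NWExtract.Approx (E := E) (test φ slot g j b r) η (k, t) (Fhat k)

/-- `B` as a set of variable names. [folklore] -/
noncomputable def BsetNat (g : X ν dNW mm Δ → Bool) (η : ℝ) : Finset ℕ := (Bset E Fhat φ slot g η).image Fin.val

variable {E Fhat φ slot}

/-- Tests only read their read set. [cite: Hirahara2022PartialMCSP, proof of Lemma 6.6] -/
theorem test_local (g : X ν dNW mm Δ → Bool) (j : Fin ν) (b : Bool) (r : BenalohLeichter.Rand (φ j))
    (z : Fin dNW → Bool) (Y Y' : Fin n × Fin Δ → Bool) (h : ∀ p ∈ readSet slot j, Y p = Y' p) :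
    test φ slot g j b r z Y = test φ slot g j b r z Y' := by
  unfold test
  have : readY slot j Y = readY slot j Y' := by
    funext i t
    unfold readY
    cases hs : slot j i with
    | none => rfl
    | some k => exact h (k, t) (mem_filter.2 ⟨mem_univ _, i, hs⟩)
  rw [this]

/-- The read set has at most `mm · Δ` positions. [cite: Hirahara2022PartialMCSP, proof of Lemma 8.3 (m' = mΔ)] -/
theorem card_readSet_le (j : Fin ν) : (readSet (Δ := Δ) slot j).card ≤ mm * Δ := by
  -- the slot variables
  have hvars : ((univ : Finset (Fin n)).filter fun k => ∃ i, slot j i = some k).card ≤ mm := by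
    have hsub : ((univ : Finset (Fin n)).filter fun k => ∃ i, slot j i = some k) ⊆
        (univ : Finset (Fin mm)).biUnion fun i => (slot j i).toFinset := by
      intro k hk
      obtain ⟨i, hi⟩ := (mem_filter.1 hk).2
      exact mem_biUnion.2 ⟨i, mem_univ _, by simp [hi]⟩
    calc _ ≤ _ := card_le_card hsub
      _ ≤ ∑ i : Fin mm, ((slot j i).toFinset).card := card_biUnion_le
      _ ≤ ∑ _i : Fin mm, 1 := sum_le_sum fun i _ => by
          cases slot j i <;> simp
      _ = mm := by simp
  have hsub : readSet (Δ := Δ) slot j ⊆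
      ((univ : Finset (Fin n)).filter fun k => ∃ i, slot j i = some k) ×ˢ (univ : Finset (Fin Δ)) := by
    intro p hp
    obtain ⟨i, hi⟩ := (mem_filter.1 hp).2
    exact mem_product.2 ⟨mem_filter.2 ⟨mem_univ _, i, hi⟩, mem_univ _⟩
  calc (readSet (Δ := Δ) slot j).card ≤ _ := card_le_card hsub
    _ = ((univ : Finset (Fin n)).filter fun k => ∃ i, slot j i = some k).card * Δ := by
        rw [card_product, card_univ, Fintype.card_fin]
    _ ≤ mm * Δ := Nat.mul_le_mul_right _ hvars

/-- A consistent test accepts the real outputs at every seed. [cite: Hirahara2022PartialMCSP, proof of Lemma 8.3] -/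
theorem test_real_of_cons {g : X ν dNW mm Δ → Bool} (hg : Cons E Fhat φ slot g) (j : Fin ν) (b : Bool)
    (r : BenalohLeichter.Rand (φ j)) (z : Fin dNW → Bool) :
    test φ slot g j b r z (NWExtract.real E (fun p => Fhat p.1) z) = true := by
  unfold test
  have := hg j z b r
  unfold point realY at this
  rw [this]; simp

end Sample

/-! ### Privacy: the one-time pad and the Benaloh–Leichter coin bijection -/

section Privacy

variable {E : Fin n × Fin Δ → (Fin ℓ ↪ Fin dNW)} {Fhat : Fin n → (Fin ℓ → Bool) → Bool}
  {φ : Fin ν → MonotoneDNF} {slot : Fin ν → Fin mm → Option (Fin n)}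

/-- The pad correction: the XOR of the `1`-share under `r` and the `0`-share under `Ψ r` of the
variable of a position. [cite: Hirahara2022PartialMCSP, proof of Lemma 8.3 ("sᵢ is uniform for i ∉ B … one-time pad")] -/
def padCorr (j : Fin ν) (Ψ : BenalohLeichter.Rand (φ j) ≃ BenalohLeichter.Rand (φ j))
    (r : BenalohLeichter.Rand (φ j)) (u : Fin n × Fin Δ → Bool) : Fin n × Fin Δ → Bool :=
  fun p => xor (u p) (xor ((BenalohLeichter.share (φ j) true r p.1).getD p.2 false)
    ((BenalohLeichter.share (φ j) false (Ψ r) p.1).getD p.2 false))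

/-- The pad correction is an involution. [folklore] -/
theorem padCorr_padCorr (j : Fin ν) (Ψ : BenalohLeichter.Rand (φ j) ≃ BenalohLeichter.Rand (φ j))
    (r : BenalohLeichter.Rand (φ j)) (u : Fin n × Fin Δ → Bool) :
    padCorr j Ψ r (padCorr j Ψ r u) = u := by
  funext p; unfold padCorr
  cases u p <;> cases (BenalohLeichter.share (φ j) true r p.1).getD p.2 false <;>
    cases (BenalohLeichter.share (φ j) false (Ψ r) p.1).getD p.2 false <;> rfl

/-- **The key equation**: with equal shares on the exempt variables, padding the uniform bits of the
other positions turns the ideal `1`-input under `r` into the ideal `0`-input under `Ψ r`.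
[cite: Hirahara2022PartialMCSP, proof of Lemma 8.3 ("the distributions of D₀ and D₁ restricted to B are identical")] -/
theorem input_padCorr (Xp : Fin n × Fin Δ → Prop) [DecidablePred Xp] (j : Fin ν)
    (Ψ : BenalohLeichter.Rand (φ j) ≃ BenalohLeichter.Rand (φ j))
    (hΨ : ∀ r (k : Fin n) (t : Fin Δ), Xp (k, t) →
      BenalohLeichter.share (φ j) false (Ψ r) k = BenalohLeichter.share (φ j) true r k)
    (r : BenalohLeichter.Rand (φ j)) (z : Fin dNW → Bool) (u : Fin n × Fin Δ → Bool) :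
    xorV (readY slot j (NWExtract.idealX E (fun p => Fhat p.1) Xp z (padCorr j Ψ r u)))
        (shareVec φ slot j false (Ψ r)) =
      xorV (readY slot j (NWExtract.idealX E (fun p => Fhat p.1) Xp z u)) (shareVec φ slot j true r) := by
  funext i t
  unfold xorV readY shareVec
  cases hs : slot j i with
  | none => rfl
  | some k =>
    simp only [NWExtract.idealX]
    by_cases hk : Xp (k, t)
    · rw [if_pos hk, if_pos hk, hΨ r k t hk]
    · rw [if_neg hk, if_neg hk]
      unfold padCorr
      cases u (k, t) <;> cases (BenalohLeichter.share (φ j) true r k).getD t false <;>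
        cases (BenalohLeichter.share (φ j) false (Ψ r) k).getD t false <;> rfl

/-- **Privacy step**: if the exempt variables seen by `φⱼ` form an unauthorized set `T`, the ideal
acceptance counts of the tests `D_{j,1,r}` and `D_{j,0,r}` sum, over all coins `r`, to exactly
`|Rand| · 2ᵈ · 2^{|P|}`. [cite: Hirahara2022PartialMCSP, proof of Lemma 8.3 (privacy of secret sharing + one-time pad ⇒ Pr = 1/2) and Lemma 4.5] -/
theorem sum_card_ideal_eq (Xp : Fin n × Fin Δ → Prop) [DecidablePred Xp] (g : X ν dNW mm Δ → Bool)
    (j : Fin ν) {T : Finset ℕ} (hT : T ∉ (φ j).accessStructure.authorized)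
    (hXT : ∀ (k : Fin n) (t : Fin Δ), Xp (k, t) → k.val ∈ T) :
    ∑ b : Bool, ∑ r : BenalohLeichter.Rand (φ j),
      ((univ.filter fun zu : (Fin dNW → Bool) × (Fin n × Fin Δ → Bool) =>
        test φ slot g j b r zu.1 (NWExtract.idealX E (fun p => Fhat p.1) Xp zu.1 zu.2)).card : ℕ) =
      Fintype.card (BenalohLeichter.Rand (φ j)) * (Fintype.card (Fin dNW → Bool) *
        Fintype.card (Fin n × Fin Δ → Bool)) := by
  -- the coin bijection of the Benaloh–Leichter scheme
  obtain ⟨Ψ, hΨ⟩ : ∃ Ψ : BenalohLeichter.Rand (φ j) ≃ BenalohLeichter.Rand (φ j), ∀ r,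
      restrictShares T (BenalohLeichter.share (φ j) false (Ψ r)) =
        restrictShares T (BenalohLeichter.share (φ j) true r) :=
    ((MonotoneDNF.blScheme (φ j)).private_iff_exists_equiv (φ j).accessStructure).1
      (MonotoneDNF.BenalohLeichter.private_ (φ j)) T hT
  have hΨ' : ∀ r (k : Fin n) (t : Fin Δ), Xp (k, t) →
      BenalohLeichter.share (φ j) false (Ψ r) k = BenalohLeichter.share (φ j) true r k :=
    fun r k t hk => (restrictShares_eq_iff _ _ _).1 (hΨ r) k.val (hXT k t hk)
  -- counts over `u` for fixed `z`
  have hcnt_eq : ∀ (b : Bool) (r : BenalohLeichter.Rand (φ j)),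
      ((univ.filter fun zu : (Fin dNW → Bool) × (Fin n × Fin Δ → Bool) =>
        test φ slot g j b r zu.1 (NWExtract.idealX E (fun p => Fhat p.1) Xp zu.1 zu.2)).card : ℕ) =
      ∑ z : Fin dNW → Bool, ((univ.filter fun u : Fin n × Fin Δ → Bool =>
        test φ slot g j b r z (NWExtract.idealX E (fun p => Fhat p.1) Xp z u)).card : ℕ) := by
    intro b r
    rw [card_filter, Fintype.sum_prod_type]
    refine sum_congr rfl fun z _ => ?_
    rw [card_filter]
  -- the complementary counts for `b = 1` under `r` and `b = 0` under `Ψ r`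
  have hpair : ∀ (r : BenalohLeichter.Rand (φ j)) (z : Fin dNW → Bool),
      ((univ.filter fun u : Fin n × Fin Δ → Bool =>
        test φ slot g j true r z (NWExtract.idealX E (fun p => Fhat p.1) Xp z u)).card : ℕ) +
      ((univ.filter fun u : Fin n × Fin Δ → Bool =>
        test φ slot g j false (Ψ r) z (NWExtract.idealX E (fun p => Fhat p.1) Xp z u)).card : ℕ) =
      Fintype.card (Fin n × Fin Δ → Bool) := by
    intro r z
    -- re-index the `0`-count by the pad correction
    have hre : ((univ.filter fun u : Fin n × Fin Δ → Bool =>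
        test φ slot g j false (Ψ r) z (NWExtract.idealX E (fun p => Fhat p.1) Xp z u)).card : ℕ) =
        ((univ.filter fun u : Fin n × Fin Δ → Bool =>
          test φ slot g j false (Ψ r) z (NWExtract.idealX E (fun p => Fhat p.1) Xp z (padCorr j Ψ r u))).card : ℕ) := by
      refine (card_bij (fun u _ => padCorr j Ψ r u) (fun u hu => ?_) (fun u _ u' _ h => ?_) (fun u hu => ?_)).symm
      · rw [mem_filter] at hu ⊢; exact ⟨mem_univ _, hu.2⟩
      · have := congrArg (padCorr j Ψ r) h
        rwa [padCorr_padCorr, padCorr_padCorr] at this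
      · refine ⟨padCorr j Ψ r u, ?_, padCorr_padCorr j Ψ r u⟩
        rw [mem_filter] at hu ⊢
        refine ⟨mem_univ _, ?_⟩
        rw [padCorr_padCorr]; exact hu.2
    have hflip : ∀ u, test φ slot g j false (Ψ r) z (NWExtract.idealX E (fun p => Fhat p.1) Xp z (padCorr j Ψ r u)) =
        !test φ slot g j true r z (NWExtract.idealX E (fun p => Fhat p.1) Xp z u) := by
      intro u
      unfold test
      rw [input_padCorr Xp j Ψ hΨ' r z u]
      cases g (j, z, xorV (readY slot j (NWExtract.idealX E (fun p => Fhat p.1) Xp z u)) (shareVec φ slot j true r)) <;> rfl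
    rw [hre]
    simp only [hflip]
    have hneg : (univ.filter fun u : Fin n × Fin Δ → Bool =>
        (!test φ slot g j true r z (NWExtract.idealX E (fun p => Fhat p.1) Xp z u)) = true) =
        univ.filter fun u : Fin n × Fin Δ → Bool =>
          ¬(test φ slot g j true r z (NWExtract.idealX E (fun p => Fhat p.1) Xp z u) = true) :=
      filter_congr fun u _ => by simp
    rw [hneg, Finset.card_filter_add_card_filter_not, card_univ]
  -- sum over `b`, re-index the `0`-sum by `Ψ`
  rw [Fintype.sum_bool]
  rw [← Equiv.sum_comp Ψ (fun r => ((univ.filter fun zu : (Fin dNW → Bool) × (Fin n × Fin Δ → Bool) =>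
        test φ slot g j false r zu.1 (NWExtract.idealX E (fun p => Fhat p.1) Xp zu.1 zu.2)).card : ℕ))]
  rw [← sum_add_distrib]
  simp_rw [hcnt_eq]
  calc ∑ r, (∑ z, ((univ.filter fun u : Fin n × Fin Δ → Bool =>
          test φ slot g j true r z (NWExtract.idealX E (fun p => Fhat p.1) Xp z u)).card : ℕ) +
        ∑ z, ((univ.filter fun u : Fin n × Fin Δ → Bool =>
          test φ slot g j false (Ψ r) z (NWExtract.idealX E (fun p => Fhat p.1) Xp z u)).card : ℕ))
      = ∑ _r : BenalohLeichter.Rand (φ j), ∑ _z : Fin dNW → Bool, Fintype.card (Fin n × Fin Δ → Bool) := by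
        refine sum_congr rfl fun r _ => ?_
        rw [← sum_add_distrib]
        exact sum_congr rfl fun z _ => hpair r z
    _ = _ := by simp [sum_const, card_univ]

end Privacy

/-! ### The key implication -/

section Key

variable {E : Fin n × Fin Δ → (Fin ℓ ↪ Fin dNW)} {Fhat : Fin n → (Fin ℓ → Bool) → Bool}
  {φ : Fin ν → MonotoneDNF} {slot : Fin ν → Fin mm → Option (Fin n)}

/-- **A consistent test makes `B` authorized for every formula** (`φⱼ(χ_B) = 1` for all `j`).
[cite: Hirahara2022PartialMCSP, proof of Lemma 8.3 (soundness: Lemma 6.6 + privacy ⇒ Pr_φ[φ(χ_B) = 1] ≥ 1 − 2ε), here with perfect consistency] -/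
theorem authorized_of_cons {η : ℝ} (hη : 0 ≤ η) (hηm : η * (mm * Δ : ℝ) < 1 / 2)
    {g : X ν dNW mm Δ → Bool} (hg : Cons E Fhat φ slot g) (j : Fin ν) :
    BsetNat E Fhat φ slot g η ∈ (φ j).accessStructure.authorized := by
  by_contra hunauth
  have hZpos : (0 : ℝ) < Fintype.card (Fin dNW → Bool) := by exact_mod_cast Fintype.card_pos
  have hUpos : (0 : ℝ) < Fintype.card (Fin n × Fin Δ → Bool) := by exact_mod_cast Fintype.card_pos
  -- Lemma 6.6 for each test `(j, b, r)`: ideal count ≥ (1 - η mm Δ) Z U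
  have hL66 : ∀ (b : Bool) (r : BenalohLeichter.Rand (φ j)),
      (Fintype.card (Fin dNW → Bool) : ℝ) * Fintype.card (Fin n × Fin Δ → Bool) -
        η * (mm * Δ) * Fintype.card (Fin dNW → Bool) * Fintype.card (Fin n × Fin Δ → Bool) ≤
        ((univ.filter fun zu : (Fin dNW → Bool) × (Fin n × Fin Δ → Bool) =>
          test φ slot g j b r zu.1 (NWExtract.idealX E (fun p => Fhat p.1)
            (fun p => p.1 ∈ Bset E Fhat φ slot g η) zu.1 zu.2)).card : ℝ) := by
    intro b r
    have hX : ∀ p ∈ readSet (Δ := Δ) slot j, ¬(fun p : Fin n × Fin Δ => p.1 ∈ Bset E Fhat φ slot g η) p →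
        ¬NWExtract.Approx (E := E) (test φ slot g j b r) η p ((fun p : Fin n × Fin Δ => Fhat p.1) p) := by
      rintro ⟨k, t⟩ _ hk happ
      exact hk (mem_filter.2 ⟨mem_univ _, j, b, r, t, happ⟩)
    have h := NWExtract.card_real_sub_ideal_le (E := E) (F := fun p => Fhat p.1)
      (X := fun p : Fin n × Fin Δ => p.1 ∈ Bset E Fhat φ slot g η)
      (D := test φ slot g j b r) (Rd := readSet slot j) (test_local g j b r) hη hX
    have hreal : ((univ.filter fun z : Fin dNW → Bool =>
        test φ slot g j b r z (NWExtract.real E (fun p => Fhat p.1) z)).card : ℝ) =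
        Fintype.card (Fin dNW → Bool) := by
      rw [← card_univ]
      congr 1
      exact congrArg Finset.card (filter_true_of_mem fun z _ => test_real_of_cons hg j b r z)
    rw [hreal] at h
    have hR : η * ((readSet (Δ := Δ) slot j).card : ℝ) * Fintype.card (Fin dNW → Bool) *
        Fintype.card (Fin n × Fin Δ → Bool) ≤
        η * (mm * Δ) * Fintype.card (Fin dNW → Bool) * Fintype.card (Fin n × Fin Δ → Bool) := by
      have hc : ((readSet (Δ := Δ) slot j).card : ℝ) ≤ mm * Δ := by exact_mod_cast card_readSet_le j
      have hZU : (0 : ℝ) ≤ (Fintype.card (Fin dNW → Bool) : ℝ) * Fintype.card (Fin n × Fin Δ → Bool) := by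
        positivity
      have key := mul_le_mul_of_nonneg_left hc (mul_nonneg hη hZU)
      linarith [key]
    linarith
  -- privacy: the counts for `b = 0, 1` sum to `|Rand| Z U`
  have hpriv := sum_card_ideal_eq (E := E) (Fhat := Fhat) (slot := slot)
    (fun p : Fin n × Fin Δ => p.1 ∈ Bset E Fhat φ slot g η)
    g j hunauth (fun k t hk => by unfold BsetNat; exact mem_image.2 ⟨k, hk, rfl⟩)
  -- sum the Lemma-6.6 bounds over `(b, r)`
  have hsumR := sum_le_sum fun b (_ : b ∈ (univ : Finset Bool)) =>
    sum_le_sum fun r (_ : r ∈ (univ : Finset (BenalohLeichter.Rand (φ j)))) => hL66 b r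
  have hrhs : ∑ b : Bool, ∑ r : BenalohLeichter.Rand (φ j),
      ((univ.filter fun zu : (Fin dNW → Bool) × (Fin n × Fin Δ → Bool) =>
        test φ slot g j b r zu.1 (NWExtract.idealX E (fun p => Fhat p.1)
          (fun p => p.1 ∈ Bset E Fhat φ slot g η) zu.1 zu.2)).card : ℝ) =
      Fintype.card (BenalohLeichter.Rand (φ j)) * ((Fintype.card (Fin dNW → Bool) : ℝ) *
        Fintype.card (Fin n × Fin Δ → Bool)) := by
    have := congrArg (fun x : ℕ => (x : ℝ)) hpriv
    push_cast at this
    exact this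
  rw [hrhs] at hsumR
  simp only [sum_const, card_univ, nsmul_eq_mul, Fintype.card_bool, Nat.cast_ofNat] at hsumR
  have hRpos : (0 : ℝ) < Fintype.card (BenalohLeichter.Rand (φ j)) := by exact_mod_cast Fintype.card_pos
  have hZU : (0 : ℝ) < (Fintype.card (Fin dNW → Bool) : ℝ) * Fintype.card (Fin n × Fin Δ → Bool) :=
    mul_pos hZpos hUpos
  have hgap : (0 : ℝ) < 1 - 2 * (η * (mm * Δ)) := by linarith
  nlinarith [mul_pos (mul_pos hRpos hZU) hgap]

end Key

end HiraharaRed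

end Literature.Computability.Complexity
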